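import Summits.BirchSwinnertonDyer.BirchSwinnertonDyer.Theses.ResidualThetaTransportAtTwo
import Summits.BirchSwinnertonDyer.BirchSwinnertonDyer.Theorems.ResidualThetaTransportAtTwoSignedMuVanishingAtTwoPlusKatoBridge
import Summits.BirchSwinnertonDyer.BirchSwinnertonDyer.Theorems.ResidualThetaTransportAtTwoSignedMuVanishingAtTwoPlusLine
import Summits.BirchSwinnertonDyer.BirchSwinnertonDyer.Theorems.ResidualThetaTransportAtTwoSignedMuVanishingAtTwoPlusFlatLayer
import Literature.NumberTheory.EllipticCurves.Kobayashi2003.SignedSelmerGeneratorChangeProofs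
import Literature.NumberTheory.EllipticCurves.Kobayashi2003.SignedSelmerDualExistsProofs
import Literature.NumberTheory.EllipticCurves.Kobayashi2003.SignedSelmerModuleFiniteProofs
import Literature.NumberTheory.EllipticCurves.KatoRankBoundProofs
import HarnessLib

/-!
# Route `ResidualThetaTransportAtTwo`, crux Kμ⁺ `SignedMuVanishingAtTwoPlus` (stmt-BirchSwinnertonDyer-20689),
# line `birth` v3: the KATO LINE — the crux BY NAME from {modularity, KATO-INT@2, (PER), (FLAT)}, with the
# algebraic conjunct VERBATIM (every cyclotomic `κ`, every topological generator)

Cell `bsd-wall`, width seat `bsd-wall-rtt-p4-w3` (helper; THEOREMS ONLY — no `def`, no named fact, no `sorry`;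
every research input is an inline hypothesis; nothing about any curve is asserted; BSD is not proved by this).
Sequel of `…SignedMuVanishingAtTwoPlusKatoBridge` (p579684), which reached the algebraic conjunct of Kμ⁺ only at
pairs `(κ, γ)` with `IsCyclotomicVariable 2 γ`. The tree's pair-change theorems for Kobayashi's signed duals
(`Kobayashi2003.SignedSelmerDualData.isTorsion_of_isTorsion_of_isCyclotomic`,
`…mu_eq_zero_of_mu_eq_zero_of_isCyclotomic`, file `Kobayashi2003/SignedSelmerGeneratorChangeProofs`: torsion-ness
and `μ = 0` of `X^ε(E/K_∞)` do not depend on the cyclotomic pair — Greenberg LNM 1716 §1, Washington §13.2) close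
that gap, so the canonical-variable form IS the verbatim conjunct:

* §1 `muAlgebraic_of_muAlgebraicCanonical` / `muAlgebraic_iff_muAlgebraicCanonical` — conjunct 1 of the crux
  (∀ cyclotomic `κ`, ∀ topological generators `γ`, ∀ f.g. `+` data: torsion ∧ `μ = 0`) ⟺ its restriction to
  cyclotomic-variable `γ` (a canonical pair exists, `exists_isCyclotomic_isTopGenerator_isCyclotomicVariable_holds`;
  a datum there exists, `nonempty_signedSelmerDualData`, and is finitely generated, `moduleFinite`).
* §2 `muAlgebraic_of_integralKato_of_periodUnit_of_flatMuZero` — conjunct 1 VERBATIM (= the line's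
  `MuAlgebraicZero`, hence the registered stub `stub_signedResidualFiniteAtTwo`'s statement,
  `signedResidualFiniteAtTwo_of_integralKato_of_periodUnit_of_flatMuZero`) from modularity `exists_isNewformOf`,
  KATO-INT@2 (route item K3 `SignedKatoDivisibilityUpToAtTwo` with exponent `0` + torsion: Kobayashi Thm 1.2 /
  1.3 (i) shape at `p = 2`), (PER) and (FLAT); `muAlgebraic_iff_integralKato_of_upTo_of_periodUnit_of_flatMuZero`
  — GRANTED K3 by name + (PER) + (FLAT) (+ modularity): conjunct 1 ⟺ KATO-INT@2.
* §3 `signedMuVanishingAtTwoPlus_of_integralKato_of_periodUnit_of_flatMuZero` — **the crux BY NAME from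
  {`exists_isNewformOf`, KATO-INT@2, (PER), (FLAT)}**, and `…_of_abbesUllmo_…` with (PER) discharged by the print
  fact `abbesUllmo_not_dvd_maninConstant_of_not_dvd_level` BY NAME; `…_of_thetaLayerUnit` variants with (FLAT) in
  θ-layer currency (p578368). A second, seed/propagation-free composition for the line `birth`: the algebraic
  stub's research content becomes ONE statement in Kato's currency (integral signed divisibility at `2`) instead of
  two (μ-seed 21438 + residual transfer 21439/22891).

References: [Kobayashi2003] Thm. 1.2, Thm. 1.3 (i); [Kato2004Asterisque] Thm. 12.5, 17.4; [GreenbergLNM1716] §1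
p. 60; [Washington1997] §13.1–13.2; [AbbesUllmo1996] Thm. A; [Pollack2003] Prop. 6.18.
-/

set_option autoImplicit false
set_option linter.dupNamespace false

noncomputable section

open scoped Classical MatrixGroups ModularForm

open CongruenceSubgroup WeierstrassCurve Literature.NumberTheory.EllipticCurves
  Literature.NumberTheory.EllipticCurves.ModularForms Literature.NumberTheory.EllipticCurves.Rank1Residual
  Literature.NumberTheory.EllipticCurves.Kobayashi2003 Literature.NumberTheory.EllipticCurves.IwasawaAlgebra
  Summit.BirchSwinnertonDyer.Rank1Residual.Supersingular Summit.BirchSwinnertonDyer.Rank1Residual.X1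
  Summit.BirchSwinnertonDyer.BirchSwinnertonDyer.Theses.ResidualThetaTransportAtTwo

namespace Summit.BirchSwinnertonDyer.BirchSwinnertonDyer.Theorems.SignedMuAtTwo

/-! ## §1. Conjunct 1: all cyclotomic pairs ⟺ cyclotomic-variable pairs -/

/-- **The algebraic conjunct of Kμ⁺ follows from its canonical-variable restriction**: torsion-ness and `μ = 0`
of a signed Selmer dual do not depend on the cyclotomic pair `(κ, γ)` (tree: Greenberg LNM 1716 §1 via
`isTorsion_of_isTorsion_of_isCyclotomic` / `mu_eq_zero_of_mu_eq_zero_of_isCyclotomic`).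
[cite: GreenbergLNM1716, §1 p. 60] [cite: Washington1997, §13.2] -/
theorem muAlgebraic_of_muAlgebraicCanonical
    (hcan : ∀ (W : WeierstrassCurve ℚ) [W.IsElliptic] [W.IsGloballyMinimal], ¬ W.HasCM → W.analyticRank = 0 →
      GoodSS W 2 → W.frobeniusTrace 2 = 0 → W.Δ < 0 →
      ∀ (κ : ZpExtension ℚ 2) (γ : Field.absoluteGaloisGroup ℚ), κ.IsCyclotomic → κ.IsTopGenerator γ →
      IsCyclotomicVariable 2 γ →
      ∀ (D : SignedSelmerDualData W κ γ 1) [Module.Finite (IwasawaAlgebra 2) D.X],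
        Module.IsTorsion (IwasawaAlgebra 2) D.X ∧ D.mu = 0) :
    ∀ (W : WeierstrassCurve ℚ) [W.IsElliptic] [W.IsGloballyMinimal], ¬ W.HasCM → W.analyticRank = 0 →
      GoodSS W 2 → W.frobeniusTrace 2 = 0 → W.Δ < 0 →
      ∀ (κ : ZpExtension ℚ 2) (γ : Field.absoluteGaloisGroup ℚ), κ.IsCyclotomic → κ.IsTopGenerator γ →
      ∀ (D : SignedSelmerDualData W κ γ 1) [Module.Finite (IwasawaAlgebra 2) D.X],
        Module.IsTorsion (IwasawaAlgebra 2) D.X ∧ D.mu = 0 := by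
  intro W _ _ hCM hr hss ha hΔ κ γ hκ hγ D _
  obtain ⟨κ₀, hκ₀, γ₀, hγ₀, hγ₀'⟩ := exists_isCyclotomic_isTopGenerator_isCyclotomicVariable_holds 2
  obtain ⟨D₀⟩ := nonempty_signedSelmerDualData W κ₀ (1 : ℤˣ) hγ₀
  haveI := SignedSelmerDualData.moduleFinite hγ₀ D₀
  obtain ⟨hT₀, hμ₀⟩ := hcan W hCM hr hss ha hΔ κ₀ γ₀ hκ₀ hγ₀ hγ₀' D₀
  exact ⟨SignedSelmerDualData.isTorsion_of_isTorsion_of_isCyclotomic hκ₀ hκ hγ₀ D₀ D hT₀,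
    SignedSelmerDualData.mu_eq_zero_of_mu_eq_zero_of_isCyclotomic hκ₀ hκ hγ₀ hγ D₀ D hT₀ hμ₀⟩

/-- **Conjunct 1 ⟺ its canonical-variable restriction.** [cite: GreenbergLNM1716, §1 p. 60] -/
theorem muAlgebraic_iff_muAlgebraicCanonical :
    (∀ (W : WeierstrassCurve ℚ) [W.IsElliptic] [W.IsGloballyMinimal], ¬ W.HasCM → W.analyticRank = 0 →
      GoodSS W 2 → W.frobeniusTrace 2 = 0 → W.Δ < 0 →
      ∀ (κ : ZpExtension ℚ 2) (γ : Field.absoluteGaloisGroup ℚ), κ.IsCyclotomic → κ.IsTopGenerator γ →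
      ∀ (D : SignedSelmerDualData W κ γ 1) [Module.Finite (IwasawaAlgebra 2) D.X],
        Module.IsTorsion (IwasawaAlgebra 2) D.X ∧ D.mu = 0) ↔
    (∀ (W : WeierstrassCurve ℚ) [W.IsElliptic] [W.IsGloballyMinimal], ¬ W.HasCM → W.analyticRank = 0 →
      GoodSS W 2 → W.frobeniusTrace 2 = 0 → W.Δ < 0 →
      ∀ (κ : ZpExtension ℚ 2) (γ : Field.absoluteGaloisGroup ℚ), κ.IsCyclotomic → κ.IsTopGenerator γ →
      IsCyclotomicVariable 2 γ →
      ∀ (D : SignedSelmerDualData W κ γ 1) [Module.Finite (IwasawaAlgebra 2) D.X],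
        Module.IsTorsion (IwasawaAlgebra 2) D.X ∧ D.mu = 0) :=
  ⟨fun h W _ _ hCM hr hss ha hΔ κ γ hκ hγ _ D _ ↦ h W hCM hr hss ha hΔ κ γ hκ hγ D,
    muAlgebraic_of_muAlgebraicCanonical⟩

/-! ## §2. Conjunct 1 VERBATIM from KATO-INT@2 ∧ (PER) ∧ (FLAT) -/

/-- **Conjunct 1 of Kμ⁺, VERBATIM, from modularity, KATO-INT@2, (PER) and (FLAT)** (p579684's canonical-variable
theorem moved to every cyclotomic pair by §1). [cite: Kobayashi2003, Thm. 1.2 and Thm. 1.3 (i)]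
[cite: GreenbergLNM1716, §1 p. 60] [cite: Pollack2003, Prop. 6.18] -/
theorem muAlgebraic_of_integralKato_of_periodUnit_of_flatMuZero (hnf : exists_isNewformOf)
    (hKato : ∀ (W : WeierstrassCurve ℚ) [W.IsElliptic] [W.IsGloballyMinimal], ¬ W.HasCM → W.analyticRank = 0 →
      GoodSS W 2 → W.frobeniusTrace 2 = 0 → W.Δ < 0 →
      ∀ (κ : ZpExtension ℚ 2) (γ : Field.absoluteGaloisGroup ℚ), κ.IsCyclotomic → κ.IsTopGenerator γ →
      IsCyclotomicVariable 2 γ →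
      ∀ [NeZero (W.conductorNorm ℤ)] (f : CuspForm (Gamma0 (W.conductorNorm ℤ)) 2), IsNewformOf W f →
      ∀ (ϖ : ℚ), (ϖ : ℝ) * W.realPeriodRat = plusPeriod f →
      ∀ (Lplus Lminus : IwasawaAlgebra 2), IsPollackPair f 2 Lplus Lminus →
      ∀ (D : SignedSelmerDualData W κ γ 1), Module.IsTorsion (IwasawaAlgebra 2) D.X ∧
        ∃ g h : IwasawaAlgebra 2, D.charIdeal = Ideal.span {g} ∧
          iwasawaToPowerSeries 2 (g * h) =
            PowerSeries.C (ϖ : ℚ_[2]) * iwasawaToPowerSeries 2 (kobayashiL 1 Lplus Lminus))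
    (hper : ∀ (W : WeierstrassCurve ℚ) [W.IsElliptic] [W.IsGloballyMinimal], GoodSS W 2 →
      ∀ [NeZero (W.conductorNorm ℤ)] (f : CuspForm (Gamma0 (W.conductorNorm ℤ)) 2), IsNewformOf W f →
      ∃ u : ℚ, ‖(u : ℚ_[2])‖ = 1 ∧ W.realPeriodRat = u * plusPeriod f)
    (hflat : ∀ (W : WeierstrassCurve ℚ) [W.IsElliptic] [W.IsGloballyMinimal], ¬ W.HasCM →
      W.analyticRank = 0 → GoodSS W 2 → W.frobeniusTrace 2 = 0 → W.Δ < 0 →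
      ∀ [NeZero (W.conductorNorm ℤ)] (f : CuspForm (Gamma0 (W.conductorNorm ℤ)) 2), IsNewformOf W f →
      ∀ (Lplus Lminus : IwasawaAlgebra 2), IsPollackPair f 2 Lplus Lminus →
      ¬ PowerSeries.C (2 : ℤ_[2]) ∣ Lminus) :
    ∀ (W : WeierstrassCurve ℚ) [W.IsElliptic] [W.IsGloballyMinimal], ¬ W.HasCM → W.analyticRank = 0 →
      GoodSS W 2 → W.frobeniusTrace 2 = 0 → W.Δ < 0 →
      ∀ (κ : ZpExtension ℚ 2) (γ : Field.absoluteGaloisGroup ℚ), κ.IsCyclotomic → κ.IsTopGenerator γ →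
      ∀ (D : SignedSelmerDualData W κ γ 1) [Module.Finite (IwasawaAlgebra 2) D.X],
        Module.IsTorsion (IwasawaAlgebra 2) D.X ∧ D.mu = 0 :=
  muAlgebraic_of_muAlgebraicCanonical
    (muAlgebraicCanonical_of_integralKato_of_periodUnit_of_flatMuZero hnf hKato hper hflat)

/-- **The registered stub's statement `SignedResidualFiniteAtTwo` (finite `X⁺/2X⁺` for every f.g. `+` datum of a
habitat⁺ curve) from modularity, KATO-INT@2, (PER) and (FLAT)** (`residualFinite_of_muAlgebraic`, p570516).
[cite: Kobayashi2003, Thm. 1.3 (i)] [cite: GreenbergVatsal2000, p. 3 (proof of Thm. (1.4))] -/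
theorem signedResidualFiniteAtTwo_of_integralKato_of_periodUnit_of_flatMuZero (hnf : exists_isNewformOf)
    (hKato : ∀ (W : WeierstrassCurve ℚ) [W.IsElliptic] [W.IsGloballyMinimal], ¬ W.HasCM → W.analyticRank = 0 →
      GoodSS W 2 → W.frobeniusTrace 2 = 0 → W.Δ < 0 →
      ∀ (κ : ZpExtension ℚ 2) (γ : Field.absoluteGaloisGroup ℚ), κ.IsCyclotomic → κ.IsTopGenerator γ →
      IsCyclotomicVariable 2 γ →
      ∀ [NeZero (W.conductorNorm ℤ)] (f : CuspForm (Gamma0 (W.conductorNorm ℤ)) 2), IsNewformOf W f →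
      ∀ (ϖ : ℚ), (ϖ : ℝ) * W.realPeriodRat = plusPeriod f →
      ∀ (Lplus Lminus : IwasawaAlgebra 2), IsPollackPair f 2 Lplus Lminus →
      ∀ (D : SignedSelmerDualData W κ γ 1), Module.IsTorsion (IwasawaAlgebra 2) D.X ∧
        ∃ g h : IwasawaAlgebra 2, D.charIdeal = Ideal.span {g} ∧
          iwasawaToPowerSeries 2 (g * h) =
            PowerSeries.C (ϖ : ℚ_[2]) * iwasawaToPowerSeries 2 (kobayashiL 1 Lplus Lminus))
    (hper : ∀ (W : WeierstrassCurve ℚ) [W.IsElliptic] [W.IsGloballyMinimal], GoodSS W 2 →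
      ∀ [NeZero (W.conductorNorm ℤ)] (f : CuspForm (Gamma0 (W.conductorNorm ℤ)) 2), IsNewformOf W f →
      ∃ u : ℚ, ‖(u : ℚ_[2])‖ = 1 ∧ W.realPeriodRat = u * plusPeriod f)
    (hflat : ∀ (W : WeierstrassCurve ℚ) [W.IsElliptic] [W.IsGloballyMinimal], ¬ W.HasCM →
      W.analyticRank = 0 → GoodSS W 2 → W.frobeniusTrace 2 = 0 → W.Δ < 0 →
      ∀ [NeZero (W.conductorNorm ℤ)] (f : CuspForm (Gamma0 (W.conductorNorm ℤ)) 2), IsNewformOf W f →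
      ∀ (Lplus Lminus : IwasawaAlgebra 2), IsPollackPair f 2 Lplus Lminus →
      ¬ PowerSeries.C (2 : ℤ_[2]) ∣ Lminus) :
    ∀ (W : WeierstrassCurve ℚ) [W.IsElliptic] [W.IsGloballyMinimal], ¬ W.HasCM → W.analyticRank = 0 →
      GoodSS W 2 → W.frobeniusTrace 2 = 0 → W.Δ < 0 →
      ∀ (κ : ZpExtension ℚ 2) (γ : Field.absoluteGaloisGroup ℚ), κ.IsCyclotomic → κ.IsTopGenerator γ →
      ∀ (D : SignedSelmerDualData W κ γ 1) [Module.Finite (IwasawaAlgebra 2) D.X],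
        Finite (D.X ⧸ (augIdealP 2 • ⊤ : Submodule (IwasawaAlgebra 2) D.X)) :=
  residualFinite_of_muAlgebraic (muAlgebraic_of_integralKato_of_periodUnit_of_flatMuZero hnf hKato hper hflat)

/-- **GRANTED the route item K3 `SignedKatoDivisibilityUpToAtTwo` (by name), (PER), (FLAT) and modularity:
conjunct 1 of Kμ⁺ (verbatim) ⟺ KATO-INT@2** (K3 with exponent `0` plus torsion).
[cite: Kobayashi2003, Thm. 1.3 (i)] [cite: Kato2004Asterisque, Thm. 17.4] [cite: GreenbergLNM1716, §1 p. 60] -/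
theorem muAlgebraic_iff_integralKato_of_upTo_of_periodUnit_of_flatMuZero (hK3 : SignedKatoDivisibilityUpToAtTwo)
    (hper : ∀ (W : WeierstrassCurve ℚ) [W.IsElliptic] [W.IsGloballyMinimal], GoodSS W 2 →
      ∀ [NeZero (W.conductorNorm ℤ)] (f : CuspForm (Gamma0 (W.conductorNorm ℤ)) 2), IsNewformOf W f →
      ∃ u : ℚ, ‖(u : ℚ_[2])‖ = 1 ∧ W.realPeriodRat = u * plusPeriod f)
    (hflat : ∀ (W : WeierstrassCurve ℚ) [W.IsElliptic] [W.IsGloballyMinimal], ¬ W.HasCM →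
      W.analyticRank = 0 → GoodSS W 2 → W.frobeniusTrace 2 = 0 → W.Δ < 0 →
      ∀ [NeZero (W.conductorNorm ℤ)] (f : CuspForm (Gamma0 (W.conductorNorm ℤ)) 2), IsNewformOf W f →
      ∀ (Lplus Lminus : IwasawaAlgebra 2), IsPollackPair f 2 Lplus Lminus →
      ¬ PowerSeries.C (2 : ℤ_[2]) ∣ Lminus)
    (hnf : exists_isNewformOf) :
    (∀ (W : WeierstrassCurve ℚ) [W.IsElliptic] [W.IsGloballyMinimal], ¬ W.HasCM → W.analyticRank = 0 →
      GoodSS W 2 → W.frobeniusTrace 2 = 0 → W.Δ < 0 →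
      ∀ (κ : ZpExtension ℚ 2) (γ : Field.absoluteGaloisGroup ℚ), κ.IsCyclotomic → κ.IsTopGenerator γ →
      ∀ (D : SignedSelmerDualData W κ γ 1) [Module.Finite (IwasawaAlgebra 2) D.X],
        Module.IsTorsion (IwasawaAlgebra 2) D.X ∧ D.mu = 0) ↔
    (∀ (W : WeierstrassCurve ℚ) [W.IsElliptic] [W.IsGloballyMinimal], ¬ W.HasCM → W.analyticRank = 0 →
      GoodSS W 2 → W.frobeniusTrace 2 = 0 → W.Δ < 0 →
      ∀ (κ : ZpExtension ℚ 2) (γ : Field.absoluteGaloisGroup ℚ), κ.IsCyclotomic → κ.IsTopGenerator γ →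
      IsCyclotomicVariable 2 γ →
      ∀ [NeZero (W.conductorNorm ℤ)] (f : CuspForm (Gamma0 (W.conductorNorm ℤ)) 2), IsNewformOf W f →
      ∀ (ϖ : ℚ), (ϖ : ℝ) * W.realPeriodRat = plusPeriod f →
      ∀ (Lplus Lminus : IwasawaAlgebra 2), IsPollackPair f 2 Lplus Lminus →
      ∀ (D : SignedSelmerDualData W κ γ 1) [Module.Finite (IwasawaAlgebra 2) D.X],
        Module.IsTorsion (IwasawaAlgebra 2) D.X ∧
        ∃ g h : IwasawaAlgebra 2, D.charIdeal = Ideal.span {g} ∧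
          iwasawaToPowerSeries 2 (g * h) =
            PowerSeries.C (ϖ : ℚ_[2]) * iwasawaToPowerSeries 2 (kobayashiL 1 Lplus Lminus)) := by
  rw [muAlgebraic_iff_muAlgebraicCanonical]
  exact muAlgebraicCanonical_iff_integralKato_of_upTo_of_periodUnit_of_flatMuZero hK3 hper hflat hnf

/-! ## §3. The crux BY NAME along the Kato line -/

/-- **The crux `SignedMuVanishingAtTwoPlus` BY NAME from {modularity, KATO-INT@2, (PER), (FLAT)}** — the line
`birth` with its algebraic stub supplied by Kato's integral signed divisibility at `2` instead of seed +
propagation (composition through the landed `signedMuVanishingAtTwoPlus_of_residualFinite_of_periodUnit_of_flatMuZero`).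
[cite: Kobayashi2003, Thm. 1.2 and Thm. 1.3 (i)] [cite: Pollack2003, Prop. 6.18] [cite: GreenbergLNM1716, §1 p. 60] -/
theorem signedMuVanishingAtTwoPlus_of_integralKato_of_periodUnit_of_flatMuZero (hnf : exists_isNewformOf)
    (hKato : ∀ (W : WeierstrassCurve ℚ) [W.IsElliptic] [W.IsGloballyMinimal], ¬ W.HasCM → W.analyticRank = 0 →
      GoodSS W 2 → W.frobeniusTrace 2 = 0 → W.Δ < 0 →
      ∀ (κ : ZpExtension ℚ 2) (γ : Field.absoluteGaloisGroup ℚ), κ.IsCyclotomic → κ.IsTopGenerator γ →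
      IsCyclotomicVariable 2 γ →
      ∀ [NeZero (W.conductorNorm ℤ)] (f : CuspForm (Gamma0 (W.conductorNorm ℤ)) 2), IsNewformOf W f →
      ∀ (ϖ : ℚ), (ϖ : ℝ) * W.realPeriodRat = plusPeriod f →
      ∀ (Lplus Lminus : IwasawaAlgebra 2), IsPollackPair f 2 Lplus Lminus →
      ∀ (D : SignedSelmerDualData W κ γ 1), Module.IsTorsion (IwasawaAlgebra 2) D.X ∧
        ∃ g h : IwasawaAlgebra 2, D.charIdeal = Ideal.span {g} ∧
          iwasawaToPowerSeries 2 (g * h) =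
            PowerSeries.C (ϖ : ℚ_[2]) * iwasawaToPowerSeries 2 (kobayashiL 1 Lplus Lminus))
    (hper : ∀ (W : WeierstrassCurve ℚ) [W.IsElliptic] [W.IsGloballyMinimal], GoodSS W 2 →
      ∀ [NeZero (W.conductorNorm ℤ)] (f : CuspForm (Gamma0 (W.conductorNorm ℤ)) 2), IsNewformOf W f →
      ∃ u : ℚ, ‖(u : ℚ_[2])‖ = 1 ∧ W.realPeriodRat = u * plusPeriod f)
    (hflat : ∀ (W : WeierstrassCurve ℚ) [W.IsElliptic] [W.IsGloballyMinimal], ¬ W.HasCM →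
      W.analyticRank = 0 → GoodSS W 2 → W.frobeniusTrace 2 = 0 → W.Δ < 0 →
      ∀ [NeZero (W.conductorNorm ℤ)] (f : CuspForm (Gamma0 (W.conductorNorm ℤ)) 2), IsNewformOf W f →
      ∀ (Lplus Lminus : IwasawaAlgebra 2), IsPollackPair f 2 Lplus Lminus →
      ¬ PowerSeries.C (2 : ℤ_[2]) ∣ Lminus) :
    SignedMuVanishingAtTwoPlus :=
  signedMuVanishingAtTwoPlus_of_residualFinite_of_periodUnit_of_flatMuZero
    (signedResidualFiniteAtTwo_of_integralKato_of_periodUnit_of_flatMuZero hnf hKato hper hflat) hper hflat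

/-- **GRANTED Abbes–Ullmo Thm. A (by name): the crux from {modularity, KATO-INT@2, (FLAT)}.**
[cite: AbbesUllmo1996, Thm. A] [cite: Kobayashi2003, Thm. 1.3 (i)] [cite: Pollack2003, Prop. 6.18] -/
theorem signedMuVanishingAtTwoPlus_of_abbesUllmo_of_integralKato_of_flatMuZero (hnf : exists_isNewformOf)
    (hAU : abbesUllmo_not_dvd_maninConstant_of_not_dvd_level)
    (hKato : ∀ (W : WeierstrassCurve ℚ) [W.IsElliptic] [W.IsGloballyMinimal], ¬ W.HasCM → W.analyticRank = 0 →
      GoodSS W 2 → W.frobeniusTrace 2 = 0 → W.Δ < 0 →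
      ∀ (κ : ZpExtension ℚ 2) (γ : Field.absoluteGaloisGroup ℚ), κ.IsCyclotomic → κ.IsTopGenerator γ →
      IsCyclotomicVariable 2 γ →
      ∀ [NeZero (W.conductorNorm ℤ)] (f : CuspForm (Gamma0 (W.conductorNorm ℤ)) 2), IsNewformOf W f →
      ∀ (ϖ : ℚ), (ϖ : ℝ) * W.realPeriodRat = plusPeriod f →
      ∀ (Lplus Lminus : IwasawaAlgebra 2), IsPollackPair f 2 Lplus Lminus →
      ∀ (D : SignedSelmerDualData W κ γ 1), Module.IsTorsion (IwasawaAlgebra 2) D.X ∧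
        ∃ g h : IwasawaAlgebra 2, D.charIdeal = Ideal.span {g} ∧
          iwasawaToPowerSeries 2 (g * h) =
            PowerSeries.C (ϖ : ℚ_[2]) * iwasawaToPowerSeries 2 (kobayashiL 1 Lplus Lminus))
    (hflat : ∀ (W : WeierstrassCurve ℚ) [W.IsElliptic] [W.IsGloballyMinimal], ¬ W.HasCM →
      W.analyticRank = 0 → GoodSS W 2 → W.frobeniusTrace 2 = 0 → W.Δ < 0 →
      ∀ [NeZero (W.conductorNorm ℤ)] (f : CuspForm (Gamma0 (W.conductorNorm ℤ)) 2), IsNewformOf W f →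
      ∀ (Lplus Lminus : IwasawaAlgebra 2), IsPollackPair f 2 Lplus Lminus →
      ¬ PowerSeries.C (2 : ℤ_[2]) ∣ Lminus) :
    SignedMuVanishingAtTwoPlus :=
  signedMuVanishingAtTwoPlus_of_integralKato_of_periodUnit_of_flatMuZero hnf hKato
    (fun _ _ _ hss _ _ hf ↦ exists_periodUnit_two_of_abbesUllmo hAU hss hf) hflat

/-- **The crux from {modularity, KATO-INT@2, (PER)} and (FLAT) in θ-LAYER currency** (every habitat⁺ newform has an
even Mazur–Tate layer with a unit coefficient; p578368's `flatMuZeroAtTwo_iff_thetaLayerUnitAtTwo`).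
[cite: Kobayashi2003, Thm. 1.3 (i)] [cite: PollackWeston2011MT, §3.1] [cite: Pollack2003, Prop. 6.18] -/
theorem signedMuVanishingAtTwoPlus_of_integralKato_of_periodUnit_of_thetaLayerUnit (hnf : exists_isNewformOf)
    (hKato : ∀ (W : WeierstrassCurve ℚ) [W.IsElliptic] [W.IsGloballyMinimal], ¬ W.HasCM → W.analyticRank = 0 →
      GoodSS W 2 → W.frobeniusTrace 2 = 0 → W.Δ < 0 →
      ∀ (κ : ZpExtension ℚ 2) (γ : Field.absoluteGaloisGroup ℚ), κ.IsCyclotomic → κ.IsTopGenerator γ →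
      IsCyclotomicVariable 2 γ →
      ∀ [NeZero (W.conductorNorm ℤ)] (f : CuspForm (Gamma0 (W.conductorNorm ℤ)) 2), IsNewformOf W f →
      ∀ (ϖ : ℚ), (ϖ : ℝ) * W.realPeriodRat = plusPeriod f →
      ∀ (Lplus Lminus : IwasawaAlgebra 2), IsPollackPair f 2 Lplus Lminus →
      ∀ (D : SignedSelmerDualData W κ γ 1), Module.IsTorsion (IwasawaAlgebra 2) D.X ∧
        ∃ g h : IwasawaAlgebra 2, D.charIdeal = Ideal.span {g} ∧
          iwasawaToPowerSeries 2 (g * h) =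
            PowerSeries.C (ϖ : ℚ_[2]) * iwasawaToPowerSeries 2 (kobayashiL 1 Lplus Lminus))
    (hper : ∀ (W : WeierstrassCurve ℚ) [W.IsElliptic] [W.IsGloballyMinimal], GoodSS W 2 →
      ∀ [NeZero (W.conductorNorm ℤ)] (f : CuspForm (Gamma0 (W.conductorNorm ℤ)) 2), IsNewformOf W f →
      ∃ u : ℚ, ‖(u : ℚ_[2])‖ = 1 ∧ W.realPeriodRat = u * plusPeriod f)
    (hθ : ∀ (W : WeierstrassCurve ℚ) [W.IsElliptic] [W.IsGloballyMinimal], ¬ W.HasCM → W.analyticRank = 0 →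
      GoodSS W 2 → W.frobeniusTrace 2 = 0 → W.Δ < 0 →
      ∀ [NeZero (W.conductorNorm ℤ)] (f : CuspForm (Gamma0 (W.conductorNorm ℤ)) 2), IsNewformOf W f →
      ∃ n : ℕ, Even n ∧ ((mazurTateElement f 2 n).map (algebraMap ℚ (PadicAlgCl 2))).supNorm = 1) :
    SignedMuVanishingAtTwoPlus :=
  signedMuVanishingAtTwoPlus_of_integralKato_of_periodUnit_of_flatMuZero hnf hKato hper
    (flatMuZeroAtTwo_iff_thetaLayerUnitAtTwo.mpr hθ)

end Summit.BirchSwinnertonDyer.BirchSwinnertonDyer.Theorems.SignedMuAtTwo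

end
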